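import Summits.ValiantsHypothesis.ValiantsHypothesis.Theorems.KPlusLogSqLawTropicalBHessenbergBlocks

/-!
# Route «KPlusLogSqLaw», crux `TropicalB` (stmt-ValiantsHypothesis-19771) — visited cut states along ONE dominant chain:
# half-slopes are monotone inside a state, so every half-slope drop is a state change (D1a′ bookkeeping)

HONEST FRAMING.  Helper file (desk docket D1a′ «visited-state bound», seat val-sym-trop-p5) toward the registered stubs
`stub_tropThin` / `stub_tropFat` of `Cruxes/TropicalB/Lines/birth.lean` (crux `TropicalB`, item stmt-ValiantsHypothesis-19771, route
KPlusLogSqLaw).  It proves NO bound on the number of visited states — that number is the crux's own content —; it only records, in the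
kernel, what the restricted-optimum toolkit (`KPlusLogSqLawTropicalBIntervalOpt.lean`) says about ONE chain at ONE column cut `t`:

* `halfSlopes_le_of_sameState` / `halfSlopes_lt_of_sameState` — two terms of a dominant chain with the SAME state
  `σ([0,t)) = σ'([0,t))` at slopes `θ < θ'` have weakly increasing left AND right half-slopes, strictly in at least one
  (both halves are restricted optima with a common image: `IntervalOpt.sl_le_of_inOpt`, `sl_lt_of_inOpt`);
* `state_ne_of_leftSlope_lt` / `state_ne_of_rightSlope_lt` — hence every step of the chain at which a half-slope DROPS changes the
  state at the cut («visited states ≥ 1 + number of non-monotone steps»);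
* `card_visitedStates_le_card_perms` — and the visited states are at most the distinct PERMUTATIONS of the chain (a state is a
  function of `σ`), so with the tree's `n + 1 ≤ #perms · (m(K−1)+1)` the visited-state question is the question «how many distinct
  permutations can a K-class dominant chain use», up to a factor `poly(mK)`.
Nothing here bears on `TropicalB` off the landed sectors, on `MatrixDescartes` (stmt-ValiantsHypothesis-18050) or on VP ≠ VNP.
[folklore]
-/

set_option linter.dupNamespace false
set_option autoImplicit false

namespace Summit.ValiantsHypothesis.ValiantsHypothesis.Theorems.KPlusLogSqLaw

open Summit.ValiantsHypothesis.ValiantsHypothesis.Theorems.MatrixDescartes.Negative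
open Summit.ValiantsHypothesis.ValiantsHypothesis.Theorems.LacunarySymmetroidMatrixDescartes
open scoped BigOperators
open Finset

namespace IntervalOpt

variable {m K : ℕ} {d : Fin K → ℕ} {v ε : Fin m → Fin m → Fin K → ℤ}

/-- the right half `[t, m)` is sent onto the complement of the image of the left half `[0, t)`. [folklore] -/
private theorem image_right_eq (t : ℕ) (σ : Equiv.Perm (Fin m)) :
    (ico m t m).image σ = Finset.univ \ (ico m 0 t).image σ := by
  have hdisj : Disjoint (ico m 0 t) (ico m t m) := by
    rw [Finset.disjoint_left]
    intro i h1 h2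
    rw [mem_ico] at h1 h2
    omega
  have hu : ico m 0 t ∪ ico m t m = Finset.univ := by
    ext i
    simp only [Finset.mem_union, mem_ico, Finset.mem_univ, iff_true]
    have := i.isLt
    omega
  rw [← Finset.image_univ_equiv σ, ← hu, Finset.image_union,
    Finset.union_sdiff_cancel_left ((Finset.disjoint_image σ.injective).2 hdisj)]

/-- **Half-slopes are monotone inside a state.**  Two dominant terms at slopes `θ ≤ θ'` with the same state `σ([0,t)) = σ'([0,t))`
have weakly increasing left and right half-slopes. [folklore] -/
theorem halfSlopes_le_of_sameState (t : ℕ) {θ θ' : ℤ} {p p' : Equiv.Perm (Fin m) × (Fin m → Fin K)}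
    (hp : IsDominant d v ε θ p) (hp' : IsDominant d v ε θ' p') (hθ : θ ≤ θ')
    (hS : (ico m 0 t).image p.1 = (ico m 0 t).image p'.1) :
    sl d (ico m 0 t) p ≤ sl d (ico m 0 t) p' ∧ sl d (ico m t m) p ≤ sl d (ico m t m) p' := by
  have o := inOpt_univ_of_isDominant hp
  have o' := inOpt_univ_of_isDominant hp'
  have hS2 : (ico m t m).image p.1 = (ico m t m).image p'.1 := by rw [image_right_eq, image_right_eq, hS]
  exact ⟨sl_le_of_inOpt (inOpt_mono (Finset.subset_univ _) o) (inOpt_mono (Finset.subset_univ _) o') hS hθ,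
    sl_le_of_inOpt (inOpt_mono (Finset.subset_univ _) o) (inOpt_mono (Finset.subset_univ _) o') hS2 hθ⟩

/-- … and strictly increasing in at least one half if the terms differ and `θ < θ'`. [folklore] -/
theorem halfSlopes_lt_of_sameState (t : ℕ) {θ θ' : ℤ} {p p' : Equiv.Perm (Fin m) × (Fin m → Fin K)}
    (hp : IsDominant d v ε θ p) (hp' : IsDominant d v ε θ' p') (hθ : θ < θ') (hne : p ≠ p')
    (hS : (ico m 0 t).image p.1 = (ico m 0 t).image p'.1) :
    sl d (ico m 0 t) p < sl d (ico m 0 t) p' ∨ sl d (ico m t m) p < sl d (ico m t m) p' := by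
  have o := inOpt_univ_of_isDominant hp
  have o' := inOpt_univ_of_isDominant hp'
  have hS2 : (ico m t m).image p.1 = (ico m t m).image p'.1 := by rw [image_right_eq, image_right_eq, hS]
  by_cases h1 : restr (ico m 0 t) p = restr (ico m 0 t) p'
  · right
    have h2 : restr (ico m t m) p ≠ restr (ico m t m) p' := by
      intro h2
      apply hne
      refine Prod.ext (Equiv.ext fun i => ?_) (funext fun i => ?_)
      · rcases Nat.lt_or_ge (i : ℕ) t with hi | hi
        · exact (restr_eq_iff.1 h1 i (by rw [mem_ico]; omega)).1
        · exact (restr_eq_iff.1 h2 i (by rw [mem_ico]; exact ⟨hi, i.isLt⟩)).1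
      · rcases Nat.lt_or_ge (i : ℕ) t with hi | hi
        · exact (restr_eq_iff.1 h1 i (by rw [mem_ico]; omega)).2
        · exact (restr_eq_iff.1 h2 i (by rw [mem_ico]; exact ⟨hi, i.isLt⟩)).2
    exact sl_lt_of_inOpt (inOpt_mono (Finset.subset_univ _) o) (inOpt_mono (Finset.subset_univ _) o') hS2 hθ h2
  · left
    exact sl_lt_of_inOpt (inOpt_mono (Finset.subset_univ _) o) (inOpt_mono (Finset.subset_univ _) o') hS hθ h1

/-- **A left half-slope drop is a state change.** [folklore] -/
theorem state_ne_of_leftSlope_lt (t : ℕ) {θ θ' : ℤ} {p p' : Equiv.Perm (Fin m) × (Fin m → Fin K)}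
    (hp : IsDominant d v ε θ p) (hp' : IsDominant d v ε θ' p') (hθ : θ ≤ θ')
    (hdrop : sl d (ico m 0 t) p' < sl d (ico m 0 t) p) : (ico m 0 t).image p.1 ≠ (ico m 0 t).image p'.1 :=
  fun hS => absurd (halfSlopes_le_of_sameState t hp hp' hθ hS).1 (not_le.2 hdrop)

/-- **A right half-slope drop is a state change.** [folklore] -/
theorem state_ne_of_rightSlope_lt (t : ℕ) {θ θ' : ℤ} {p p' : Equiv.Perm (Fin m) × (Fin m → Fin K)}
    (hp : IsDominant d v ε θ p) (hp' : IsDominant d v ε θ' p') (hθ : θ ≤ θ')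
    (hdrop : sl d (ico m t m) p' < sl d (ico m t m) p) : (ico m 0 t).image p.1 ≠ (ico m 0 t).image p'.1 :=
  fun hS => absurd (halfSlopes_le_of_sameState t hp hp' hθ hS).2 (not_le.2 hdrop)

/-- **Visited states are at most the distinct permutations of the chain** (a state is a function of the permutation). [folklore] -/
theorem card_visitedStates_le_card_perms (t : ℕ) {n : ℕ} (p : Fin (n + 1) → Equiv.Perm (Fin m) × (Fin m → Fin K)) :
    (Finset.univ.image fun k => (ico m 0 t).image (p k).1).card ≤ (Finset.univ.image fun k => (p k).1).card := by
  classical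
  have he : (Finset.univ.image fun k => (ico m 0 t).image (p k).1) =
      (Finset.univ.image fun k => (p k).1).image fun σ : Equiv.Perm (Fin m) => (ico m 0 t).image σ := by
    rw [Finset.image_image]
    rfl
  rw [he]
  exact Finset.card_image_le

end IntervalOpt

end Summit.ValiantsHypothesis.ValiantsHypothesis.Theorems.KPlusLogSqLaw
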